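import Literature.Analysis.FluidPDE.TorusClassicalHnBalance
import Literature.Analysis.FunctionSpaces.TorusEnstrophyOrthogonality
import Literature.Analysis.FunctionSpaces.TorusClassicalNSGluing
import Literature.Analysis.FluidPDE.LinearizedNSTorus
import Literature.Analysis.FluidPDE.AlexakisDoeringInterpolation

/-!
# Planar steady states under a fixed smooth force carry no anomalous dissipation (solo soloist, blind mode)

Exclusion E3 of the steady reading of the zeroth law, with its RATE: for a smooth steady state
`(U, P)` of the forced Navier–Stokes system on the two-dimensional flat torus `T²`
(`Torus.IsSteadyNSState ν f U P`, i.e. `(U·∇)U = νΔU − ∇P + f`, `div U = 0`) with smooth force `f`,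

* `planar_enstrophy_eq` — the **steady enstrophy identity** `ν ∫‖ΔU‖² = −∫⟪Δf, U⟫`: pair the momentum
  equation with `ΔU` (the tree's `H¹` balance `IsClassicalNSSolutionOn.hasDerivWithinAt_half_gradNormSq`,
  Foias–Manley–Rosa–Temam 2001 App. II.A (A.55), applied to the time-independent solution, whose
  `½‖∇U‖²` has derivative zero), kill the trilinear term by the two-dimensional orthogonality
  `∫⟪ΔU, (U·∇)U⟫ = 0` (FMRT (A.62) = `Torus.integral_inner_laplacian_convect_self_eq_zero`) and move
  both derivatives onto `f` (Green);
* `gradNormSq_sq_le` — interpolation `‖∇U‖₂⁴ ≤ ∫‖U‖² · ∫‖ΔU‖²` (Green + Cauchy–Schwarz, any dimension);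
* `planar_dissipation_pow_four_le` — hence **`(ν‖∇U‖₂²)⁴ ≤ ν² (∫‖U‖²)³ ∫‖Δf‖²`**, i.e.
  `ν‖∇U‖₂² ≤ ν^{1/2} E^{3/4} ‖Δf‖₂^{1/2}` with `E = ∫‖U‖²`;
* `planar_steady_dissipation_tendsto_zero` — so along ANY family of planar steady states with viscosities
  `νⱼ → 0`, a FIXED smooth force and uniformly bounded energy, the dissipation `νⱼ‖∇Uⱼ‖₂²` tends to zero
  (at rate `νⱼ^{1/2}`): a planar steady witness of the zeroth law is impossible, quantitatively.

This is the steady, rate-explicit core of the two-dimensional "no anomalous dissipation of energy"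
statements (Alexakis–Doering 2006 for statistically steady forcing; Constantin–Ramos 2007, the tree's
named fact `Literature.Analysis.FluidPDE.constantin_ramos_2d`, for the damped-driven time-dependent
problem); the one-line mechanism is that in 2-D the enstrophy budget bounds `ν‖ΔU‖₂²` by the
`ν`-INDEPENDENT quantity `‖Δf‖₂ E^{1/2}`, two derivatives better than the energy budget.
[cite: FoiasManleyRosaTemam2001, App. II.A (A.55), (A.62)] [cite: AlexakisDoering2006PLA, §2]
[cite: ConstantinRamos2007, §1–2]
-/

open MeasureTheory Filter Topology Set
open scoped ENNReal NNReal InnerProductSpace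

noncomputable section

namespace Summit.AnomalousDissipation.AnomalousDissipation.Theorems

open Literature.Analysis.FunctionSpaces Literature.Analysis.FluidPDE

/-- The two-dimensional flat unit torus (local notation). -/
local notation "𝕋²" => UnitAddTorus (Fin 2)
/-- Planar velocity values (local notation). -/
local notation "E²" => EuclideanSpace ℝ (Fin 2)

variable {d : Type*} [Fintype d] [DecidableEq d]

/-- **Steady `H¹` balance (any dimension)**: for a smooth steady state,
`ν ∫‖ΔU‖² = ∫⟪(U·∇)U − f, ΔU⟫` (the enstrophy equation FMRT (A.55) at a time-independent solution:
`d/dt ½‖∇U‖² = 0`, uniqueness of one-sided derivatives on `[0,1]`). [cite: FoiasManleyRosaTemam2001, App. II.A (A.55)] -/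
theorem steady_enstrophy_balance {ν : ℝ} {f U : UnitAddTorus d → EuclideanSpace ℝ d}
    {P : UnitAddTorus d → ℝ} (h : Torus.IsSteadyNSState ν f U P) :
    ν * ∫ x, ‖Torus.laplacian U x‖ ^ 2 =
      ∫ x, ⟪Torus.convect U U x - f x, Torus.laplacian U x⟫_ℝ := by
  have h01 : Torus.IsClassicalNSSolutionOn (Icc (0 : ℝ) 1) ν (fun _ => f) (fun _ => U) (fun _ => P) :=
    Torus.IsClassicalNSSolutionOn.mono h (subset_univ _) (uniqueDiffOn_Icc zero_lt_one)
  have ht : (0 : ℝ) ∈ Icc (0 : ℝ) 1 := ⟨le_rfl, zero_le_one⟩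
  have hb := h01.hasDerivWithinAt_half_gradNormSq zero_lt_one ht
  have hc : HasDerivWithinAt (fun _ : ℝ => 2⁻¹ * Torus.gradNormSq U) 0 (Icc (0 : ℝ) 1) 0 :=
    (hasDerivAt_const (0 : ℝ) _).hasDerivWithinAt
  have hud : UniqueDiffWithinAt ℝ (Icc (0 : ℝ) 1) 0 := uniqueDiffOn_Icc zero_lt_one 0 ht
  have heq := hud.eq_deriv _ hb hc
  linarith

/-- **Planar steady enstrophy identity** `ν ∫‖ΔU‖² = −∫⟪Δf, U⟫` for a smooth steady state on `T²`
with smooth force: the trilinear term drops by the two-dimensional orthogonality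
`∫⟪ΔU, (U·∇)U⟫ = 0` (FMRT (A.62)) and Green's second identity moves `Δ` onto `f`.
[cite: FoiasManleyRosaTemam2001, App. II.A (A.62)] -/
theorem planar_enstrophy_eq {ν : ℝ} {f U : 𝕋² → E²} {P : 𝕋² → ℝ}
    (h : Torus.IsSteadyNSState ν f U P) (hf : Torus.IsSmooth f) :
    ν * ∫ x, ‖Torus.laplacian U x‖ ^ 2 = -∫ x, ⟪Torus.laplacian f x, U x⟫_ℝ := by
  have hU : Torus.IsSmooth U :=
    (Torus.IsClassicalNSSolutionOn.smooth_velocity h).isSmooth_slice (mem_univ (0 : ℝ))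
  have hdiv : Torus.IsDivFree U := Torus.IsClassicalNSSolutionOn.divFree h 0 (mem_univ _)
  have hΔ : Torus.IsSmooth (Torus.laplacian U) := hU.laplacian
  have hconv : Torus.IsSmooth (Torus.convect U U) := hU.convect hU
  have horth : ∫ x, ⟪Torus.convect U U x, Torus.laplacian U x⟫_ℝ = 0 := by
    have h0 := Torus.integral_inner_laplacian_convect_self_eq_zero hU hdiv
    simpa [real_inner_comm] using h0
  have hgreen : ∫ x, ⟪f x, Torus.laplacian U x⟫_ℝ = ∫ x, ⟪Torus.laplacian f x, U x⟫_ℝ :=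
    (Torus.integral_inner_laplacian_comm hf hU).symm
  have hsplit : ∫ x, ⟪Torus.convect U U x - f x, Torus.laplacian U x⟫_ℝ =
      (∫ x, ⟪Torus.convect U U x, Torus.laplacian U x⟫_ℝ) - ∫ x, ⟪f x, Torus.laplacian U x⟫_ℝ := by
    simp_rw [inner_sub_left]
    exact integral_sub (hconv.inner hΔ).integrable (hf.inner hΔ).integrable
  rw [steady_enstrophy_balance h, hsplit, horth, hgreen, zero_sub]

/-- **Interpolation** `‖∇U‖₂⁴ ≤ ∫‖U‖² · ∫‖ΔU‖²` for a smooth field (Green `‖∇U‖₂² = −∫⟪ΔU, U⟫`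
and Cauchy–Schwarz; any dimension). [folklore] -/
theorem gradNormSq_sq_le {U : UnitAddTorus d → EuclideanSpace ℝ d} (hU : Torus.IsSmooth U) :
    Torus.gradNormSq U ^ 2 ≤ (∫ x, ‖U x‖ ^ 2) * ∫ x, ‖Torus.laplacian U x‖ ^ 2 := by
  have hΔ : Torus.IsSmooth (Torus.laplacian U) := hU.laplacian
  have hG : Torus.gradNormSq U = -∫ x, ⟪Torus.laplacian U x, U x⟫_ℝ := by
    rw [Torus.integral_inner_laplacian_self_eq_neg_gradNormSq hU]; ring
  have hUc : Continuous U := hU.continuous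
  have hΔc : Continuous (Torus.laplacian U) := hΔ.continuous
  have hint : Integrable (fun x => ⟪Torus.laplacian U x, U x⟫_ℝ) volume := (hΔ.inner hU).integrable
  have hE : Integrable (fun x => ‖U x‖ ^ 2) volume :=
    (hUc.norm.pow 2).integrable_of_hasCompactSupport (HasCompactSupport.of_compactSpace _)
  have hL : Integrable (fun x => ‖Torus.laplacian U x‖ ^ 2) volume :=
    (hΔc.norm.pow 2).integrable_of_hasCompactSupport (HasCompactSupport.of_compactSpace _)
  have hcs : -∫ x, ⟪Torus.laplacian U x, U x⟫_ℝ ≤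
      Real.sqrt ((∫ x, ‖U x‖ ^ 2) * ∫ x, ‖Torus.laplacian U x‖ ^ 2) := by
    calc -∫ x, ⟪Torus.laplacian U x, U x⟫_ℝ ≤ ∫ x, |⟪Torus.laplacian U x, U x⟫_ℝ| := by
          rw [← integral_neg]
          exact integral_mono hint.neg hint.abs fun x => neg_le_abs _
      _ ≤ Real.sqrt ((∫ x, ‖U x‖ ^ 2) * ∫ x, ‖Torus.laplacian U x‖ ^ 2) := by
          refine integral_le_sqrt_integral_mul_integral (ae_of_all _ fun x => abs_nonneg _)
            (ae_of_all _ fun x => sq_nonneg _) (ae_of_all _ fun x => sq_nonneg _)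
            (ae_of_all _ fun x => ?_) (hΔc.inner hUc).abs.aestronglyMeasurable hE hL
          rw [← mul_pow, mul_comm ‖U x‖]
          exact pow_le_pow_left₀ (abs_nonneg _) (abs_real_inner_le_norm _ _) 2
  have hnn : 0 ≤ (∫ x, ‖U x‖ ^ 2) * ∫ x, ‖Torus.laplacian U x‖ ^ 2 :=
    mul_nonneg (integral_nonneg fun _ => sq_nonneg _) (integral_nonneg fun _ => sq_nonneg _)
  rw [hG]
  calc (-∫ x, ⟪Torus.laplacian U x, U x⟫_ℝ) ^ 2
      ≤ (Real.sqrt ((∫ x, ‖U x‖ ^ 2) * ∫ x, ‖Torus.laplacian U x‖ ^ 2)) ^ 2 :=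
        pow_le_pow_left₀ (by rw [← hG]; exact Torus.gradNormSq_nonneg U) hcs 2
    _ = (∫ x, ‖U x‖ ^ 2) * ∫ x, ‖Torus.laplacian U x‖ ^ 2 := Real.sq_sqrt hnn

/-- **Planar steady dissipation bound with rate**: for a smooth steady state on `T²` with smooth force
and `0 ≤ ν`, `(ν‖∇U‖₂²)⁴ ≤ ν² (∫‖U‖²)³ ∫‖Δf‖²`, i.e. `ν‖∇U‖₂² ≤ ν^{1/2} E^{3/4} ‖Δf‖₂^{1/2}`
(`planar_enstrophy_eq` + Cauchy–Schwarz gives `ν∫‖ΔU‖² ≤ ‖Δf‖₂ E^{1/2}`; combine with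
`gradNormSq_sq_le`). [cite: AlexakisDoering2006PLA, §2] -/
theorem planar_dissipation_pow_four_le {ν : ℝ} {f U : 𝕋² → E²} {P : 𝕋² → ℝ}
    (h : Torus.IsSteadyNSState ν f U P) (hf : Torus.IsSmooth f) (hν : 0 ≤ ν) :
    (ν * Torus.gradNormSq U) ^ 4 ≤
      ν ^ 2 * (∫ x, ‖U x‖ ^ 2) ^ 3 * ∫ x, ‖Torus.laplacian f x‖ ^ 2 := by
  have hU : Torus.IsSmooth U :=
    (Torus.IsClassicalNSSolutionOn.smooth_velocity h).isSmooth_slice (mem_univ (0 : ℝ))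
  have hΔf : Torus.IsSmooth (Torus.laplacian f) := hf.laplacian
  set E : ℝ := ∫ x, ‖U x‖ ^ 2 with hE_def
  set L : ℝ := ∫ x, ‖Torus.laplacian U x‖ ^ 2 with hL_def
  set F : ℝ := ∫ x, ‖Torus.laplacian f x‖ ^ 2 with hF_def
  have hE0 : 0 ≤ E := integral_nonneg fun _ => sq_nonneg _
  have hL0 : 0 ≤ L := integral_nonneg fun _ => sq_nonneg _
  have hF0 : 0 ≤ F := integral_nonneg fun _ => sq_nonneg _
  have h1 : Torus.gradNormSq U ^ 2 ≤ E * L := gradNormSq_sq_le hU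
  -- `ν L = -∫⟪Δf, U⟫ ≤ √(F E)`
  have hUc : Continuous U := hU.continuous
  have hΔfc : Continuous (Torus.laplacian f) := hΔf.continuous
  have hint : Integrable (fun x => ⟪Torus.laplacian f x, U x⟫_ℝ) volume := (hΔf.inner hU).integrable
  have hEi : Integrable (fun x => ‖U x‖ ^ 2) volume :=
    (hUc.norm.pow 2).integrable_of_hasCompactSupport (HasCompactSupport.of_compactSpace _)
  have hFi : Integrable (fun x => ‖Torus.laplacian f x‖ ^ 2) volume :=
    (hΔfc.norm.pow 2).integrable_of_hasCompactSupport (HasCompactSupport.of_compactSpace _)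
  have h2 : ν * L ≤ Real.sqrt (F * E) := by
    rw [hL_def, planar_enstrophy_eq h hf]
    calc -∫ x, ⟪Torus.laplacian f x, U x⟫_ℝ ≤ ∫ x, |⟪Torus.laplacian f x, U x⟫_ℝ| := by
          rw [← integral_neg]
          exact integral_mono hint.neg hint.abs fun x => neg_le_abs _
      _ ≤ Real.sqrt (F * E) := by
          refine integral_le_sqrt_integral_mul_integral (ae_of_all _ fun x => abs_nonneg _)
            (ae_of_all _ fun x => sq_nonneg _) (ae_of_all _ fun x => sq_nonneg _)
            (ae_of_all _ fun x => ?_) (hΔfc.inner hUc).abs.aestronglyMeasurable hFi hEi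
          rw [← mul_pow]
          exact pow_le_pow_left₀ (abs_nonneg _) (abs_real_inner_le_norm _ _) 2
  have h2sq : (ν * L) ^ 2 ≤ F * E := by
    calc (ν * L) ^ 2 ≤ (Real.sqrt (F * E)) ^ 2 := pow_le_pow_left₀ (mul_nonneg hν hL0) h2 2
      _ = F * E := Real.sq_sqrt (mul_nonneg hF0 hE0)
  have hG0 : 0 ≤ Torus.gradNormSq U := Torus.gradNormSq_nonneg U
  calc (ν * Torus.gradNormSq U) ^ 4 = ν ^ 2 * (Torus.gradNormSq U ^ 2) ^ 2 * ν ^ 2 := by ring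
    _ ≤ ν ^ 2 * (E * L) ^ 2 * ν ^ 2 := by gcongr
    _ = ν ^ 2 * E ^ 2 * (ν * L) ^ 2 := by ring
    _ ≤ ν ^ 2 * E ^ 2 * (F * E) := by gcongr
    _ = ν ^ 2 * E ^ 3 * F := by ring

/-- **No anomalous dissipation for bounded-energy planar steady states under a fixed smooth force**:
if `(Uⱼ, Pⱼ)` are smooth steady states on `T²` with viscosities `νⱼ > 0`, `νⱼ → 0`, the SAME smooth force
`f`, and `∫‖Uⱼ‖² ≤ E₀`, then `νⱼ‖∇Uⱼ‖₂² → 0` (indeed `≤ νⱼ^{1/2} E₀^{3/4} ‖Δf‖₂^{1/2}`). The planar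
analogue of the steady zeroth law is therefore false: a steady witness must be genuinely
three-dimensional. [cite: AlexakisDoering2006PLA, §2] [cite: ConstantinRamos2007, §1–2] -/
theorem planar_steady_dissipation_tendsto_zero {ν : ℕ → ℝ} {f : 𝕋² → E²} {U : ℕ → 𝕋² → E²}
    {P : ℕ → 𝕋² → ℝ} (hf : Torus.IsSmooth f) (hν : ∀ j, 0 < ν j) (hν₀ : Tendsto ν atTop (𝓝 0))
    (h : ∀ j, Torus.IsSteadyNSState (ν j) f (U j) (P j)) {E₀ : ℝ}
    (hE : ∀ j, ∫ x, ‖U j x‖ ^ 2 ≤ E₀) :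
    Tendsto (fun j => ν j * Torus.gradNormSq (U j)) atTop (𝓝 0) := by
  set F : ℝ := ∫ x, ‖Torus.laplacian f x‖ ^ 2 with hF_def
  have hF0 : 0 ≤ F := integral_nonneg fun _ => sq_nonneg _
  have hE00 : 0 ≤ E₀ := (integral_nonneg fun _ => sq_nonneg _).trans (hE 0)
  set C : ℝ := Real.sqrt (E₀ ^ 3 * F) with hC_def
  have hC0 : 0 ≤ C := Real.sqrt_nonneg _
  have ha0 : ∀ j, 0 ≤ ν j * Torus.gradNormSq (U j) := fun j =>
    mul_nonneg (hν j).le (Torus.gradNormSq_nonneg _)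
  -- `(νⱼ Gⱼ)² ≤ νⱼ C`
  have hsq : ∀ j, (ν j * Torus.gradNormSq (U j)) ^ 2 ≤ ν j * C := by
    intro j
    have hEj0 : 0 ≤ ∫ x, ‖U j x‖ ^ 2 := integral_nonneg fun _ => sq_nonneg _
    have h4 : (ν j * Torus.gradNormSq (U j)) ^ 4 ≤ ν j ^ 2 * E₀ ^ 3 * F :=
      calc (ν j * Torus.gradNormSq (U j)) ^ 4
          ≤ ν j ^ 2 * (∫ x, ‖U j x‖ ^ 2) ^ 3 * F := planar_dissipation_pow_four_le (h j) hf (hν j).le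
        _ ≤ ν j ^ 2 * E₀ ^ 3 * F := by gcongr; exact hE j
    have h4' : ((ν j * Torus.gradNormSq (U j)) ^ 2) ^ 2 ≤ (ν j * C) ^ 2 := by
      calc ((ν j * Torus.gradNormSq (U j)) ^ 2) ^ 2 = (ν j * Torus.gradNormSq (U j)) ^ 4 := by ring
        _ ≤ ν j ^ 2 * E₀ ^ 3 * F := h4
        _ = (ν j * C) ^ 2 := by
            rw [mul_pow, hC_def, Real.sq_sqrt (mul_nonneg (pow_nonneg hE00 3) hF0)]; ring
    exact le_of_pow_le_pow_left₀ two_ne_zero (mul_nonneg (hν j).le hC0) h4'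
  -- squeeze the squares, then take square roots
  have hsq0 : Tendsto (fun j => (ν j * Torus.gradNormSq (U j)) ^ 2) atTop (𝓝 0) := by
    have hup : Tendsto (fun j => ν j * C) atTop (𝓝 0) := by
      simpa using hν₀.mul_const C
    exact squeeze_zero (fun j => sq_nonneg _) hsq hup
  have hroot : Tendsto (fun j => Real.sqrt ((ν j * Torus.gradNormSq (U j)) ^ 2)) atTop (𝓝 0) := by
    have hc := (Real.continuous_sqrt.tendsto 0).comp hsq0
    rw [Real.sqrt_zero] at hc
    exact hc
  refine hroot.congr' (Eventually.of_forall fun j => ?_)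
  exact Real.sqrt_sq (ha0 j)

end Summit.AnomalousDissipation.AnomalousDissipation.Theorems

end
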